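import Mathlib
import Summits.Ventures.PercRepro.PuncturedLYM

/-!
# PercRepro — (SP) BY POINT SPLITTING: FLOWS ON A FINITE GROUND SET, THE GLUING LEMMA, THE AVERAGING IDENTITY
(p10, gen 36)

The punctured normalised matching property (SP) of a family `P` of `j`-subsets of a ground set `S` against all
`(j+1)`-subsets of `S` is equivalent (max-flow / min-cut) to a FLOW: weights `w X Y ≥ 0` on the pairs `X ⊂ Y` with
prescribed row sums `ρ X` (`X ∈ P`) and column sums `ν Y`.  THE POINT SPLITTING: for a point `x ∈ S`, the rows avoiding
`x` together with the columns avoiding `x` form the instance of `S ∖ x` at level `j`, the rows containing `x` together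
with the columns containing `x` (both with `x` removed) form the instance of `S ∖ x` at level `j − 1`, and the only
edges between the two halves are the CROSS edges `X → X ∪ {x}` (`x ∉ X`).  Putting `κ` on every cross edge:

* `hasFlow_glue` — a flow of the `x`-free half with row sums `ρ − κ` and a flow of the `x`-half with column demands
  `ν − κ` on the columns that received a cross edge glue to a flow of the whole instance (`κ ≥ 0`);
* `sum_excess` — THE AVERAGING IDENTITY: `Σ_x (ν(columns ∋ x) − ρ(rows ∋ x)) = (j+1)·ν(all) − j·ρ(all)`, so when the
  totals agree some point has nonnegative excess `t(x)`, which is the total cross mass the split at `x` must carry;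
* `hasFlow_free` — the Boolean lattice: the constant flow `ρ/(n−j)` on all `j`-subsets of `S`;
* `puncturedNMP_of_hasFlow` — the bridge to the tree's `PuncturedNMP` (gen 30's weighted-Hall master lemma) for the
  uniform instance on the whole type.
Nothing here asserts (SP).
-/

namespace PercRepro.PuncturedLYM.Split

open Finset

variable {α : Type} [DecidableEq α]

/-! ### The objects -/

/-- The columns: all `(j+1)`-subsets of the ground set `S`. -/
def cols (S : Finset α) (j : ℕ) : Finset (Finset α) := S.powersetCard (j + 1)

/-- The supersets of `X` inside `S` with one more element: the `insert y X`, `y ∈ S ∖ X`. -/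
def sups (S X : Finset α) : Finset (Finset α) := (S \ X).image (fun y => insert y X)

/-- The rows of `P` contained in `Y`. -/
def subs (P : Finset (Finset α)) (Y : Finset α) : Finset (Finset α) := P.filter (fun X => X ⊆ Y)

/-- `w` is a flow of the instance `(S, j, P, ρ, ν)`: nonnegative, row sums `ρ` on `P`, column sums `ν` on the
`(j+1)`-subsets of `S`. -/
structure IsFlow (S : Finset α) (j : ℕ) (P : Finset (Finset α)) (ρ ν : Finset α → ℚ)
    (w : Finset α → Finset α → ℚ) : Prop where
  nonneg : ∀ X Y, 0 ≤ w X Y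
  row : ∀ X ∈ P, ∑ Y ∈ sups S X, w X Y = ρ X
  col : ∀ Y ∈ cols S j, ∑ X ∈ subs P Y, w X Y = ν Y

/-- The instance `(S, j, P, ρ, ν)` has a flow. -/
def HasFlow (S : Finset α) (j : ℕ) (P : Finset (Finset α)) (ρ ν : Finset α → ℚ) : Prop :=
  ∃ w, IsFlow S j P ρ ν w

/-! ### Membership facts -/

omit [DecidableEq α] in
/-- A column is a `(j+1)`-subset of `S`. -/
theorem mem_cols {S Y : Finset α} {j : ℕ} : Y ∈ cols S j ↔ Y ⊆ S ∧ Y.card = j + 1 := by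
  simp [cols, mem_powersetCard]

/-- The supersets of `X` inside `S` are the `insert y X`, `y ∈ S ∖ X`. -/
theorem mem_sups {S X Y : Finset α} : Y ∈ sups S X ↔ ∃ y ∈ S, y ∉ X ∧ Y = insert y X := by
  simp only [sups, mem_image, mem_sdiff]
  constructor
  · rintro ⟨y, ⟨hyS, hyX⟩, rfl⟩; exact ⟨y, hyS, hyX, rfl⟩
  · rintro ⟨y, hyS, hyX, rfl⟩; exact ⟨y, ⟨hyS, hyX⟩, rfl⟩

/-- The rows below `Y` are the members of `P` contained in `Y`. -/
theorem mem_subs {P : Finset (Finset α)} {X Y : Finset α} : X ∈ subs P Y ↔ X ∈ P ∧ X ⊆ Y := by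
  simp [subs]

/-- `insert · X` is injective on the complement of `X`. -/
theorem insert_injOn (S X : Finset α) : Set.InjOn (fun y => insert y X) ((S \ X : Finset α) : Set α) := by
  intro y hy z hz h
  rw [mem_coe, mem_sdiff] at hy hz
  simp only at h
  have hyz : y ∈ insert z X := by rw [← h]; exact mem_insert_self y X
  rcases mem_insert.1 hyz with hyz | hyz
  · exact hyz
  · exact absurd hyz hy.2

/-- `X` has `#(S ∖ X)` supersets inside `S`. -/
theorem card_sups (S X : Finset α) : (sups S X).card = (S \ X).card := by
  unfold sups
  exact card_image_of_injOn (insert_injOn S X)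

/-- Sums over the supersets of `X` are sums over the added point. -/
theorem sum_sups (S X : Finset α) (f : Finset α → ℚ) :
    ∑ Y ∈ sups S X, f Y = ∑ y ∈ S \ X, f (insert y X) := by
  unfold sups
  exact sum_image (insert_injOn S X)

/-- A superset of a `j`-subset of `S` inside `S` is a column. -/
theorem sups_subset_cols {S X : Finset α} {j : ℕ} (hX : X ⊆ S) (hXc : X.card = j) :
    sups S X ⊆ cols S j := by
  intro Y hY
  obtain ⟨y, hyS, hyX, rfl⟩ := mem_sups.1 hY
  rw [mem_cols]
  exact ⟨insert_subset hyS hX, by rw [card_insert_of_notMem hyX, hXc]⟩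

/-! ### The gluing lemma -/

/-- The rows of the `x`-free half: the members of `P` avoiding `x`. -/
def rowsFree (P : Finset (Finset α)) (x : α) : Finset (Finset α) := P.filter (fun X => x ∉ X)

/-- The rows of the `x`-half: the members of `P` containing `x`, with `x` removed. -/
def rowsLink (P : Finset (Finset α)) (x : α) : Finset (Finset α) :=
  (P.filter (fun X => x ∈ X)).image (fun X => X.erase x)

/-- Membership in the `x`-free rows. -/
theorem mem_rowsFree {P : Finset (Finset α)} {x : α} {X : Finset α} :
    X ∈ rowsFree P x ↔ X ∈ P ∧ x ∉ X := by simp [rowsFree]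

/-- Membership in the `x`-half rows: `X'` avoids `x` and `X' ∪ {x}` is a row. -/
theorem mem_rowsLink {P : Finset (Finset α)} {x : α} {X' : Finset α} :
    X' ∈ rowsLink P x ↔ x ∉ X' ∧ insert x X' ∈ P := by
  simp only [rowsLink, mem_image, mem_filter]
  constructor
  · rintro ⟨X, ⟨hXP, hxX⟩, rfl⟩
    exact ⟨notMem_erase x X, by rwa [insert_erase hxX]⟩
  · rintro ⟨hx, hP⟩
    exact ⟨insert x X', ⟨hP, mem_insert_self x X'⟩, by rw [erase_insert hx]⟩

/-- The glued weights: `w₁` (shifted by `x`) on pairs containing `x`, `κ` on the cross pairs `X → X ∪ {x}`, `w₀` on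
the pairs avoiding `x`. -/
def glueWeight (x : α) (κ : ℚ) (w₀ w₁ : Finset α → Finset α → ℚ) (X Y : Finset α) : ℚ :=
  if x ∈ X then w₁ (X.erase x) (Y.erase x) else if x ∈ Y then κ else w₀ X Y

/-- **THE GLUING LEMMA.** Let `x ∈ S`, `P` a family of `j`-subsets of `S`, `0 < j`, `κ ≥ 0`.  If the `x`-free half
`(S ∖ x, j, rowsFree P x)` has a flow with row sums `ρ − κ` and column demands `ν`, and the `x`-half
`(S ∖ x, j − 1, rowsLink P x)` has a flow with row sums `ρ (insert x ·)` and column demands `ν (insert x ·) − κ·[· ∈ P]`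
(the columns whose `x`-removal is a row received the cross edge), then `(S, j, P, ρ, ν)` has a flow. -/
theorem hasFlow_glue {S : Finset α} {j : ℕ} {P : Finset (Finset α)} (hP : P ⊆ S.powersetCard j) (hj : 0 < j)
    {ρ ν : Finset α → ℚ} {x : α} (hx : x ∈ S) {κ : ℚ} (hκ : 0 ≤ κ)
    (h0 : HasFlow (S.erase x) j (rowsFree P x) (fun X => ρ X - κ) ν)
    (h1 : HasFlow (S.erase x) (j - 1) (rowsLink P x) (fun X' => ρ (insert x X'))
      (fun Y' => ν (insert x Y') - if Y' ∈ P then κ else 0)) :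
    HasFlow S j P ρ ν := by
  obtain ⟨w₀, hw₀⟩ := h0
  obtain ⟨w₁, hw₁⟩ := h1
  refine ⟨glueWeight x κ w₀ w₁, ?_, ?_, ?_⟩
  · -- nonnegativity
    intro X Y
    unfold glueWeight
    split_ifs
    · exact hw₁.nonneg _ _
    · exact hκ
    · exact hw₀.nonneg _ _
  · -- row sums
    intro X hXP
    rw [sum_sups]
    by_cases hxX : x ∈ X
    · -- the row contains `x`: it is a row of the `x`-half
      have hmem : X.erase x ∈ rowsLink P x := mem_rowsLink.2 ⟨notMem_erase x X, by rwa [insert_erase hxX]⟩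
      have hrow := hw₁.row _ hmem
      rw [sum_sups, insert_erase hxX] at hrow
      have hset : S \ X = S.erase x \ X.erase x := by
        ext y
        simp only [mem_sdiff, mem_erase]
        constructor
        · rintro ⟨hyS, hyX⟩
          have hyx : y ≠ x := fun h => hyX (h ▸ hxX)
          exact ⟨⟨hyx, hyS⟩, fun h => hyX h.2⟩
        · rintro ⟨⟨hyx, hyS⟩, hyX⟩
          exact ⟨hyS, fun h => hyX ⟨hyx, h⟩⟩
      rw [hset, ← hrow]
      apply sum_congr rfl
      intro y hy
      have hyx : y ≠ x := (mem_erase.1 (mem_sdiff.1 hy).1).1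
      simp only [glueWeight, if_pos hxX, erase_insert_of_ne hyx]
    · -- the row avoids `x`: one cross edge (`y = x`) plus a row of the `x`-free half
      have hmem : X ∈ rowsFree P x := mem_rowsFree.2 ⟨hXP, hxX⟩
      have hrow := hw₀.row _ hmem
      rw [sum_sups] at hrow
      have hset : S \ X = insert x (S.erase x \ X) := by
        ext y
        simp only [mem_sdiff, mem_insert, mem_erase]
        constructor
        · rintro ⟨hyS, hyX⟩
          by_cases hyx : y = x
          · exact Or.inl hyx
          · exact Or.inr ⟨⟨hyx, hyS⟩, hyX⟩
        · rintro (rfl | ⟨⟨_, hyS⟩, hyX⟩)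
          · exact ⟨hx, hxX⟩
          · exact ⟨hyS, hyX⟩
      have hxnot : x ∉ S.erase x \ X := fun h => (mem_erase.1 (mem_sdiff.1 h).1).1 rfl
      rw [hset, sum_insert hxnot]
      have hcross : glueWeight x κ w₀ w₁ X (insert x X) = κ := by
        simp only [glueWeight, if_neg hxX, if_pos (mem_insert_self x X)]
      have hrest : ∑ y ∈ S.erase x \ X, glueWeight x κ w₀ w₁ X (insert y X) = ρ X - κ := by
        rw [← hrow]
        apply sum_congr rfl
        intro y hy
        have hyx : y ≠ x := (mem_erase.1 (mem_sdiff.1 hy).1).1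
        have hxY : x ∉ insert y X := by
          rw [mem_insert]; rintro (h | h)
          · exact hyx h.symm
          · exact hxX h
        simp only [glueWeight, if_neg hxX, if_neg hxY]
      rw [hcross, hrest]; ring
  · -- column sums
    intro Y hY
    obtain ⟨hYS, hYc⟩ := mem_cols.1 hY
    by_cases hxY : x ∈ Y
    · -- the column contains `x`: its rows containing `x` are the rows of the `x`-half below `Y ∖ x`,
      -- and its only row avoiding `x` is `Y ∖ x` (when it is a row), carrying the cross edge
      have hYx : Y.erase x ∈ cols (S.erase x) (j - 1) := by
        rw [mem_cols]
        refine ⟨erase_subset_erase x hYS, ?_⟩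
        rw [card_erase_of_mem hxY, hYc]; omega
      have hcol := hw₁.col _ hYx
      rw [insert_erase hxY] at hcol
      rw [← sum_filter_add_sum_filter_not (subs P Y) (fun X => x ∈ X)]
      -- the rows containing `x`
      have h1 : ∑ X ∈ (subs P Y).filter (fun X => x ∈ X), glueWeight x κ w₀ w₁ X Y
          = ∑ X' ∈ subs (rowsLink P x) (Y.erase x), w₁ X' (Y.erase x) := by
        symm
        apply sum_nbij' (fun X' => insert x X') (fun X => X.erase x)
        · intro X' hX'
          rw [mem_subs, mem_rowsLink] at hX'
          rw [mem_filter, mem_subs]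
          exact ⟨⟨hX'.1.2, insert_subset hxY (hX'.2.trans (erase_subset x Y))⟩, mem_insert_self x X'⟩
        · intro X hX
          rw [mem_filter, mem_subs] at hX
          rw [mem_subs, mem_rowsLink]
          exact ⟨⟨notMem_erase x X, by rw [insert_erase hX.2]; exact hX.1.1⟩, erase_subset_erase x hX.1.2⟩
        · intro X' hX'
          rw [mem_subs, mem_rowsLink] at hX'
          exact erase_insert hX'.1.1
        · intro X hX
          rw [mem_filter] at hX
          exact insert_erase hX.2
        · intro X' hX'
          rw [mem_subs, mem_rowsLink] at hX'
          simp only [glueWeight, if_pos (mem_insert_self x X'), erase_insert hX'.1.1]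
      -- the rows avoiding `x`
      have h2 : ∑ X ∈ (subs P Y).filter (fun X => ¬ x ∈ X), glueWeight x κ w₀ w₁ X Y
          = if Y.erase x ∈ P then κ else 0 := by
        have hfil : (subs P Y).filter (fun X => ¬ x ∈ X) = if Y.erase x ∈ P then {Y.erase x} else ∅ := by
          ext X
          rw [mem_filter, mem_subs]
          constructor
          · rintro ⟨⟨hXP, hXY⟩, hxX⟩
            have hXS : X.card = j := (mem_powersetCard.1 (hP hXP)).2
            have hXeq : X = Y.erase x := by
              apply eq_of_subset_of_card_le
              · intro y hy; exact mem_erase.2 ⟨fun h => hxX (h ▸ hy), hXY hy⟩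
              · rw [card_erase_of_mem hxY, hYc, hXS]; omega
            subst hXeq
            rw [if_pos hXP]; exact mem_singleton_self _
          · intro hX
            split_ifs at hX with hYP
            · rw [mem_singleton] at hX; subst hX
              exact ⟨⟨hYP, erase_subset x Y⟩, notMem_erase x Y⟩
            · exact absurd hX (notMem_empty _)
        rw [hfil]
        split_ifs with hYP
        · rw [sum_singleton]
          simp only [glueWeight, if_neg (notMem_erase x Y), if_pos hxY]
        · rfl
      rw [h1, h2, hcol]; ring
    · -- the column avoids `x`: all its rows avoid `x` and it is a column of the `x`-free half
      have hY0 : Y ∈ cols (S.erase x) j := by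
        rw [mem_cols]; exact ⟨subset_erase.2 ⟨hYS, hxY⟩, hYc⟩
      have hcol := hw₀.col _ hY0
      have hsubs : subs (rowsFree P x) Y = subs P Y := by
        ext X
        simp only [mem_subs, mem_rowsFree]
        constructor
        · rintro ⟨⟨hXP, _⟩, hXY⟩; exact ⟨hXP, hXY⟩
        · rintro ⟨hXP, hXY⟩; exact ⟨⟨hXP, fun h => hxY (hXY h)⟩, hXY⟩
      rw [hsubs] at hcol
      rw [← hcol]
      apply sum_congr rfl
      intro X hX
      have hxX : x ∉ X := fun h => hxY ((mem_subs.1 hX).2 h)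
      simp only [glueWeight, if_neg hxX, if_neg hxY]

/-! ### The averaging identity -/

/-- The EXCESS of a point `x`: the demand of the columns containing `x` minus the mass of the rows containing `x` —
the total cross mass that a split at `x` must carry from the `x`-free rows into the `x`-columns. -/
def excess (S : Finset α) (j : ℕ) (P : Finset (Finset α)) (ρ ν : Finset α → ℚ) (x : α) : ℚ :=
  (∑ Y ∈ (cols S j).filter (fun Y => x ∈ Y), ν Y) - ∑ X ∈ P.filter (fun X => x ∈ X), ρ X

/-- Columns are `(j+1)`-sets and rows `j`-sets: summing the excess over the points counts every column `j + 1` times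
and every row `j` times. -/
theorem sum_excess (S : Finset α) (j : ℕ) (P : Finset (Finset α)) (hP : P ⊆ S.powersetCard j)
    (ρ ν : Finset α → ℚ) :
    ∑ x ∈ S, excess S j P ρ ν x = (j + 1) * ∑ Y ∈ cols S j, ν Y - j * ∑ X ∈ P, ρ X := by
  unfold excess
  rw [sum_sub_distrib]
  congr 1
  · rw [sum_comm' (t' := cols S j) (s' := fun Y => Y)]
    · rw [mul_sum]
      apply sum_congr rfl
      intro Y hY
      rw [sum_const, nsmul_eq_mul, (mem_cols.1 hY).2]
      push_cast; ring
    · intro x Y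
      simp only [mem_filter, mem_cols]
      constructor
      · rintro ⟨_, ⟨hYS, hYc⟩, hxY⟩; exact ⟨hxY, hYS, hYc⟩
      · rintro ⟨hxY, hYS, hYc⟩; exact ⟨hYS hxY, ⟨hYS, hYc⟩, hxY⟩
  · rw [sum_comm' (t' := P) (s' := fun X => X)]
    · rw [mul_sum]
      apply sum_congr rfl
      intro X hX
      have hXc : X.card = j := (mem_powersetCard.1 (hP hX)).2
      rw [sum_const, nsmul_eq_mul, hXc]
    · intro x X
      simp only [mem_filter]
      constructor
      · rintro ⟨_, hXP, hxX⟩; exact ⟨hxX, hXP⟩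
      · rintro ⟨hxX, hXP⟩; exact ⟨(mem_powersetCard.1 (hP hXP)).1 hxX, hXP, hxX⟩

/-- When the total demand equals the total mass, the excesses sum to the total: some point has excess at least
`total / #S`; in particular some point has nonnegative excess. -/
theorem exists_excess_nonneg (S : Finset α) (j : ℕ) (P : Finset (Finset α)) (hP : P ⊆ S.powersetCard j)
    (ρ ν : Finset α → ℚ) (htot : ∑ Y ∈ cols S j, ν Y = ∑ X ∈ P, ρ X) (h0 : 0 ≤ ∑ X ∈ P, ρ X)
    (hS : S.Nonempty) : ∃ x ∈ S, 0 ≤ excess S j P ρ ν x := by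
  by_contra hcon
  simp only [not_exists, not_and, not_le] at hcon
  have hsum : ∑ x ∈ S, excess S j P ρ ν x < 0 := by
    have := sum_lt_sum_of_nonempty hS (fun x hx => hcon x hx)
    simpa using this
  rw [sum_excess S j P hP, htot] at hsum
  have : (j + 1 : ℚ) * ∑ X ∈ P, ρ X - j * ∑ X ∈ P, ρ X = ∑ X ∈ P, ρ X := by ring
  rw [this] at hsum
  exact absurd hsum (not_lt.2 h0)

/-! ### The Boolean lattice -/

/-- All `j`-subsets of `S` inside a `(j+1)`-subset `Y ⊆ S` are the `j`-subsets of `Y`. -/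
theorem subs_powersetCard {S Y : Finset α} {j : ℕ} (hYS : Y ⊆ S) :
    subs (S.powersetCard j) Y = Y.powersetCard j := by
  ext X
  simp only [mem_subs, mem_powersetCard]
  constructor
  · rintro ⟨⟨_, hXc⟩, hXY⟩; exact ⟨hXY, hXc⟩
  · rintro ⟨hXY, hXc⟩; exact ⟨⟨hXY.trans hYS, hXc⟩, hXY⟩

/-- **The free flow.** On the full level `C(S, j)` with `j < #S` the constant weight `ρ/(#S − j)` has row sums `ρ`
and column sums `(j + 1)·ρ/(#S − j)`. -/
theorem hasFlow_free (S : Finset α) (j : ℕ) (hj : j < S.card) (ρ : ℚ) (hρ : 0 ≤ ρ) :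
    HasFlow S j (S.powersetCard j) (fun _ => ρ) (fun _ => (j + 1) * ρ / (S.card - j)) := by
  have hpos : (0 : ℚ) < S.card - j := by
    have : (j : ℚ) < S.card := by exact_mod_cast hj
    linarith
  refine ⟨fun _ _ => ρ / (S.card - j), ?_, ?_, ?_⟩
  · exact fun X Y => div_nonneg hρ hpos.le
  · intro X hX
    obtain ⟨hXS, hXc⟩ := mem_powersetCard.1 hX
    rw [sum_const, card_sups, card_sdiff_of_subset hXS, hXc, nsmul_eq_mul]
    rw [Nat.cast_sub hj.le]
    field_simp
  · intro Y hY
    obtain ⟨hYS, hYc⟩ := mem_cols.1 hY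
    rw [subs_powersetCard hYS, sum_const, card_powersetCard, hYc, Nat.choose_succ_self_right, nsmul_eq_mul]
    push_cast
    ring

/-! ### The bridge to the tree's `PuncturedNMP` -/

/-- The tree's supersets `sups j X` (gen 30) are the supersets inside `univ`. -/
theorem sups_univ_eq [Fintype α] {j : ℕ} {X : Finset α} (hX : X.card = j) :
    PuncturedLYM.sups j X = sups univ X := by
  rw [PuncturedLYM.sups_eq hX]; rfl

/-- **The bridge.** A flow of the uniform instance (rows `1/#P`, columns `1/#Y`) of the punctured level of a code on
the whole type gives (SP) for that code, by gen 30's weighted-Hall master lemma. -/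
theorem puncturedNMP_of_hasFlow [Fintype α] {j : ℕ} {D : Finset (Finset α)}
    (h : HasFlow univ j (punctured j D) (fun _ => 1 / ((punctured j D).card : ℚ))
      (fun _ => 1 / ((levelAbove α j).card : ℚ))) :
    PuncturedNMP j D := by
  obtain ⟨w, hw⟩ := h
  intro 𝒜 h𝒜
  rcases Nat.eq_zero_or_pos (punctured j D).card with hP0 | hPpos
  · rw [card_eq_zero] at hP0
    rw [hP0, subset_empty] at h𝒜
    subst h𝒜; simp
  rcases Nat.eq_zero_or_pos (levelAbove α j).card with hL0 | hLpos
  · rw [hL0]; simp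
  have hP : (0 : ℚ) < (punctured j D).card := by exact_mod_cast hPpos
  have hL : (0 : ℚ) < (levelAbove α j).card := by exact_mod_cast hLpos
  have key := PuncturedLYM.card_upNbhd_ge_of_weights (fun X Y => (levelAbove α j).card * w X Y)
    ((levelAbove α j).card / (punctured j D).card)
    (fun X Y => mul_nonneg hL.le (hw.nonneg X Y)) ?_ ?_ h𝒜
  · rw [← mul_div_assoc, div_le_iff₀ hP] at key
    exact_mod_cast key
  · intro X hX
    have hXc : X.card = j := (mem_powersetCard.1 (mem_sdiff.1 hX).1).2
    rw [sups_univ_eq hXc, ← mul_sum, hw.row X hX]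
    rw [div_eq_mul_one_div]
  · intro Y hY
    have hsub : PuncturedLYM.subsP j D Y = subs (punctured j D) Y := rfl
    rw [hsub, ← mul_sum, hw.col Y hY, mul_one_div, div_self hL.ne']
end PercRepro.PuncturedLYM.Split
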